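import Literature.AnabelianGeometry.EtaleTheta.FrobenioidThetaDivisorSupportAdjacencyCount
import Literature.AnabelianGeometry.EtaleTheta.ChainDivisorCriteria

/-!
# [EtTh] §5, Proposition 5.3 (iv): the incidence sentence of p.326 is FORCED by the intersection theory of the chain
(GAP-LEDGER G-L2d4-2, part 4: F3 `DivisorSupportData'.incidence` derived, not posited)

Mochizuki, *The étale theta function …*, Publ. RIMS **45** (2009)
[cite: MochizukiEtTh2009, Prop 5.3 proof p.326 (PDF p.100); §1 p.240 (PDF p.14)].
Seat abc-iut-L6-d1 (gen 4); proof-only, over the repaired data `DivisorSupportData'`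
(`FrobenioidThetaDivisorSupportR.lean`, this lineage), its toolkit (`…SupportOrders.lean`, `…SupportIntersection.lean`,
`…SupportAdjacencyCount.lean`) and — as the abstract combinatorial core, consumed BY NAME — abc-iut-w5-d203's
`ChainDivisorCriteria.lean` (`ChainDivisors.cspToNcsp_criterion`, `ChainDivisors.incidence_structure_of_le`: cusps `K`,
components `ℤ`, `π : K → ℤ`, cuspidal order functions `K → ℚ` and their `finsum` degrees).  This file supplies the
dictionary `Φ(A_⊚)^gp ∋ x ↦ (𝔠 ↦ ord_𝔠 x)` on the cuspidal primes, `π = ncspEquivZ ∘ cspToNcsp`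
(`cuspDeg_ord`, `degOn_eq_cuspDeg_of_isCuspidalGp`, `encard_support_ord_of_isCuspidalGp`).

WHAT IS PROVED.  Field F3 `incidence` of `DivisorSupportData'` types the p.326 sentence "in this situation [`a ∈ 𝔞`
primary cuspidal, `n ∈ 𝔫` primary non-cuspidal, `b` cuspidal coprime to `a`, `b − a` cuspidally minimal and linearly
equivalent to `n`], `n` is linearly equivalent to some element ∈ `Φ(A_⊚)^gp` of the form `n₁ + n₂ − a`, where
`n₁, n₂ ∈ Φ(A_⊚)^csp` are primary cuspidal elements that map, respectively, via the natural surjection of (iv) to the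
two non-cuspidal primes that are adjacent … to the non-cuspidal prime determined by `n`. Moreover, … the
multiplicities of `n₁, n₂` are equal to each other as well as to half the multiplicity of `a`."  Here it is DERIVED
from the structural binder of row G-L2d4-2 — "principal ⇔ degree `0` on every irreducible component" ([EtTh] §1
p.240 (PDF p.14): "these degrees determine an isomorphism `Pic(𝔜_N) ⥲ ℤ^ℤ`") — for an ARBITRARY subgroup `P` of
`Φ(A_⊚)^gp` playing the role of the principal elements (so that the statement is not the field restated):
* `incidence_structure_of_degree` — the SHARP form: in the situation of (iv) everything is forced by one integer
  `m ≥ 1`: `𝔞 ↦ 𝔫`, `n = m·gen 𝔫`, `a = 2m·gen 𝔞`, and `b = m·gen 𝔠₁ + m·gen 𝔠₂` for cusps `𝔠₁ ↦ 𝔫⁻`, `𝔠₂ ↦ 𝔫⁺`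
  over the two neighbours of `𝔫` in the chain (the competitor `m·𝔠₁ + m·𝔠₂ − 2m·𝔞 ∼ b − a` has three cusps, so
  minimality pins `supp(b − a) = {𝔞, 𝔠₁, 𝔠₂}` and the degrees pin the multiplicities);
* `incidence_of_degree` — the F3 sentence for such `P`; `incidence_of_principalIffDegreeZero` — the F3 FIELD TYPE
  verbatim for `𝔖.principal` under `𝔖.PrincipalIffDegreeZero`, proved without using the field: F3 is REDUNDANT given
  the binder;
* `incidence_of_top` — with `P = ⊤` the hypotheses of F3 are contradictory (a cuspidally minimal element would have
  empty support, but `𝔞 ∈ supp(b − a)`), over the RAW factorization data.  RECIPE for whoever CONSTRUCTS the genuine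
  `DivisorSupportData'` at `Ÿ` (abc-iut-L2-t9 / the special-fibre owner): build `𝔖₀` with `principal := ⊤`,
  `incidence := incidence_of_top …` from F2/F5/F6 alone; then the genuine datum is
  `{ 𝔖₀ with principal := P, incidence := 𝔖₀.incidence_of_degree P hI }` where `hI : ∀ x, IsPrincipalOf P x ↔ ∀ 𝔪,
  𝔖₀.degOn 𝔪 x = 0` is the binder (`degOn` depends on F2 only) — i.e. F3 costs nothing beyond `hInt`.
HONEST FRAMING: implications between predicates on OUR typed data; the binder is discharged by nobody here; typed ≠
proved for the genuine curve; no side taken on anything downstream; nothing here lies inside the [IUTchIII] Cor. 3.12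
cone. -/

namespace Literature.AnabelianGeometry.EtaleTheta

open CategoryTheory
open Literature.AlgebraicGeometry.Frobenioids

universe w v v' u u'

namespace FrobenioidThetaDivisors

open scoped Classical

/-! ### Linear equivalence for an arbitrary subgroup `P` -/

section LinEquiv

variable {Φ : Type w} [CommMonoid Φ] (P : Subgroup (Algebra.GrothendieckGroup Φ))

/-- `x` is principal for `P` iff `x ∈ P`. [cite: MochizukiEtTh2009, Prop 5.3 proof p.326 (PDF p.100)] -/
theorem isPrincipalOf_iff_mem (z : Algebra.GrothendieckGroup Φ) : IsPrincipalOf P z ↔ z ∈ P := by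
  rw [IsPrincipalOf, LinEquivOf, inv_one, mul_one]

/-- Linear equivalence is symmetric. [cite: MochizukiEtTh2009, Prop 5.3 proof p.326 (PDF p.100)] -/
theorem linEquivOf_symm {x y : Algebra.GrothendieckGroup Φ} (h : LinEquivOf P x y) : LinEquivOf P y x := by
  rw [LinEquivOf] at h ⊢
  have := P.inv_mem h
  rwa [mul_inv_rev, inv_inv] at this

/-- Linear equivalence is transitive. [cite: MochizukiEtTh2009, Prop 5.3 proof p.326 (PDF p.100)] -/
theorem linEquivOf_trans {x y z : Algebra.GrothendieckGroup Φ} (h₁ : LinEquivOf P x y) (h₂ : LinEquivOf P y z) :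
    LinEquivOf P x z := by
  rw [LinEquivOf] at h₁ h₂ ⊢
  have := P.mul_mem h₁ h₂
  rwa [mul_assoc, inv_mul_cancel_left] at this

end LinEquiv

variable {C : Type u} [Category.{v} C] {D : Type u'} [Category.{v'} D] {𝔉 : ThetaFrobenioid.{w} C D}
variable {𝔓 : DivisorPrimeData 𝔉}

/-! ### F3 is vacuous for `P = ⊤` (bootstrap of the two-step construction), over the raw factorization data -/

/-- **With `P = ⊤` the hypotheses of F3 are contradictory**: every element is then linearly equivalent to `0`, whose
support is empty, so a cuspidally minimal element has empty support — but `𝔞 ∈ supp(b − a)` (`a ∈ 𝔞` primary, `b`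
coprime to `a`).  Stated over the RAW data (`factor`, `gen` and the F2 clause `factor_carrier`), for use as the
`incidence` field of a bootstrap datum with `principal := ⊤`.  [cite: MochizukiEtTh2009, Prop 5.3 proof p.326 (PDF p.100)] -/
theorem incidence_of_top (factor : 𝔉.PhiAcirc →* (Primes 𝔉.PhiAcirc → Multiplicative ℚ))
    (gen : Primes 𝔉.PhiAcirc → 𝔉.PhiAcirc)
    (factor_carrier : ∀ (𝔭 : Primes 𝔉.PhiAcirc) (a : 𝔉.PhiAcirc),
      a ∈ 𝔭.carrier ↔ ∃ n : ℕ, 0 < n ∧ factor a 𝔭 = Multiplicative.ofAdd (n : ℚ) ∧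
        ∀ 𝔮 : Primes 𝔉.PhiAcirc, 𝔮 ≠ 𝔭 → factor a 𝔮 = 1)
    (𝔞 𝔫 : Primes 𝔉.PhiAcirc) (h𝔫 : ¬ 𝔓.IsCuspidal 𝔫) (a b n : 𝔉.PhiAcirc) :
    𝔓.IsCuspidal 𝔞 → a ∈ 𝔞.carrier → n ∈ 𝔫.carrier →
    IsCuspidalGpOf' 𝔓 factor (Algebra.GrothendieckGroup.of b) →
    CoprimeOf' factor (Algebra.GrothendieckGroup.of a) (Algebra.GrothendieckGroup.of b) →
    IsCuspidallyMinimalOf' 𝔓 factor ⊤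
      (Algebra.GrothendieckGroup.of b * (Algebra.GrothendieckGroup.of a)⁻¹) →
    LinEquivOf ⊤ (Algebra.GrothendieckGroup.of b * (Algebra.GrothendieckGroup.of a)⁻¹)
      (Algebra.GrothendieckGroup.of n) →
    ∃ (𝔠₁ 𝔠₂ : Primes 𝔉.PhiAcirc) (h₁ : 𝔓.IsCuspidal 𝔠₁) (h₂ : 𝔓.IsCuspidal 𝔠₂) (m : ℕ),
      𝔓.ncspEquivZ (𝔓.cspToNcsp ⟨𝔠₁, h₁⟩) = 𝔓.ncspEquivZ ⟨𝔫, h𝔫⟩ - 1 ∧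
      𝔓.ncspEquivZ (𝔓.cspToNcsp ⟨𝔠₂, h₂⟩) = 𝔓.ncspEquivZ ⟨𝔫, h𝔫⟩ + 1 ∧
      ordOf' factor 𝔞 a = Multiplicative.ofAdd (2 * (m : ℚ)) ∧
      LinEquivOf ⊤ (Algebra.GrothendieckGroup.of n)
        (Algebra.GrothendieckGroup.of (gen 𝔠₁ ^ m * gen 𝔠₂ ^ m) *
          (Algebra.GrothendieckGroup.of a)⁻¹) := by
  intro _ ha _ _ hcop hmin _
  exfalso
  -- the order at `𝔞` of `a` on `Φ(A_⊚)^gp`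
  obtain ⟨α, hα, hα𝔞, -⟩ := (factor_carrier 𝔞 a).mp ha
  have hlift : ∀ c : 𝔉.PhiAcirc, ordGpOf' factor 𝔞 (Algebra.GrothendieckGroup.of c) = factor c 𝔞 := by
    intro c
    have h := Algebra.GrothendieckGroup.lift.symm_apply_apply (ordOf' factor 𝔞)
    rw [Algebra.GrothendieckGroup.lift_symm_apply] at h
    exact DFunLike.congr_fun h c
  have h𝔞a : 𝔞 ∈ suppOf' factor (Algebra.GrothendieckGroup.of a) := by
    change ordGpOf' factor 𝔞 (Algebra.GrothendieckGroup.of a) ≠ 1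
    rw [hlift, hα𝔞]
    have : (α : ℚ) ≠ 0 := Nat.cast_ne_zero.mpr hα.ne'
    exact fun h => this (by simpa using congrArg Multiplicative.toAdd h)
  have h𝔞b : ordGpOf' factor 𝔞 (Algebra.GrothendieckGroup.of b) = 1 := by
    by_contra h
    exact Set.disjoint_left.mp hcop h𝔞a h
  -- `𝔞` lies in the support of `b − a`
  have h𝔞x : 𝔞 ∈ suppOf' factor (Algebra.GrothendieckGroup.of b * (Algebra.GrothendieckGroup.of a)⁻¹) := by
    change ordGpOf' factor 𝔞 _ ≠ 1
    rw [map_mul, map_inv, h𝔞b, one_mul, inv_ne_one]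
    exact h𝔞a
  -- but the cuspidally minimal `b − a` is linearly equivalent to `1`, of empty support
  have h1 : suppOf' factor (1 : Algebra.GrothendieckGroup 𝔉.PhiAcirc) = ∅ := by
    ext 𝔭
    simp only [suppOf', map_one, ne_eq, not_true_eq_false, Set.mem_setOf_eq, Set.mem_empty_iff_false]
  have hle := hmin.2.2 1 (fun 𝔭 h𝔭 => by rw [h1] at h𝔭; exact absurd h𝔭 (Set.notMem_empty _))
    (by rw [h1]; exact Set.finite_empty) (Subgroup.mem_top _)
  rw [h1, Set.ncard_empty, Nat.le_zero, Set.ncard_eq_zero hmin.2.1] at hle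
  rw [hle] at h𝔞x
  exact Set.notMem_empty _ h𝔞x

namespace DivisorSupportData'

variable (𝔖 : DivisorSupportData' 𝔓)

/-! ### The dictionary to the abstract chain-divisor combinatorics -/

/-- **Dictionary, degrees.**  The abstract cuspidal degree (`ChainDivisors.cuspDeg`, `π = ncspEquivZ ∘ cspToNcsp`) of
the order function `𝔠 ↦ ord_𝔠 x` over the label of the component `𝔪` is the cusp sum of `degOn 𝔪 x`.
[cite: MochizukiEtTh2009, §1 p.240 (PDF p.14); Prop 5.3 proof p.326 (PDF p.100)] -/
theorem cuspDeg_ord (x : Algebra.GrothendieckGroup 𝔉.PhiAcirc) (𝔪 : {p : Primes 𝔉.PhiAcirc // ¬ 𝔓.IsCuspidal p}) :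
    ChainDivisors.cuspDeg
        (fun 𝔠 : {p : Primes 𝔉.PhiAcirc // 𝔓.IsCuspidal p} => 𝔓.ncspEquivZ (𝔓.cspToNcsp 𝔠))
        (fun 𝔠 => 𝔖.ord 𝔠.1 x) (𝔓.ncspEquivZ 𝔪) =
      ∑ᶠ 𝔠 ∈ {𝔠 : {p : Primes 𝔉.PhiAcirc // 𝔓.IsCuspidal p} | 𝔓.cspToNcsp 𝔠 = 𝔪}, 𝔖.ord 𝔠.1 x := by
  have hset : (fun 𝔠 : {p : Primes 𝔉.PhiAcirc // 𝔓.IsCuspidal p} => 𝔓.ncspEquivZ (𝔓.cspToNcsp 𝔠)) ⁻¹'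
      {𝔓.ncspEquivZ 𝔪} = {𝔠 | 𝔓.cspToNcsp 𝔠 = 𝔪} := by
    ext 𝔠
    simp only [Set.mem_preimage, Set.mem_singleton_iff, Set.mem_setOf_eq, EmbeddingLike.apply_eq_iff_eq]
  rw [ChainDivisors.cuspDeg, hset]

/-- **Dictionary, degrees of cuspidal elements.**  For a cuspidal `x` (vertical part `0`), `degOn 𝔪 x` IS the abstract
cuspidal degree over the label of `𝔪`.  [cite: MochizukiEtTh2009, §1 p.240 (PDF p.14); Prop 5.3 proof p.326 (PDF p.100)] -/
theorem degOn_eq_cuspDeg_of_isCuspidalGp {x : Algebra.GrothendieckGroup 𝔉.PhiAcirc} (hx : 𝔖.IsCuspidalGp x)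
    (𝔪 : {p : Primes 𝔉.PhiAcirc // ¬ 𝔓.IsCuspidal p}) :
    𝔖.degOn 𝔪 x = ChainDivisors.cuspDeg
        (fun 𝔠 : {p : Primes 𝔉.PhiAcirc // 𝔓.IsCuspidal p} => 𝔓.ncspEquivZ (𝔓.cspToNcsp 𝔠))
        (fun 𝔠 => 𝔖.ord 𝔠.1 x) (𝔓.ncspEquivZ 𝔪) := by
  rw [cuspDeg_ord, degOn, 𝔖.vert_eq_zero_of_isCuspidalGp 𝔪 hx, zero_add]

/-- **Dictionary, supports.**  The support of the order function of `x` on the cuspidal primes is the preimage of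
`supp x`.  [cite: MochizukiEtTh2009, Prop 5.3 proof p.326 (PDF p.100)] -/
theorem support_ord_eq (x : Algebra.GrothendieckGroup 𝔉.PhiAcirc) :
    (Function.support fun 𝔠 : {p : Primes 𝔉.PhiAcirc // 𝔓.IsCuspidal p} => 𝔖.ord 𝔠.1 x) =
      Subtype.val ⁻¹' 𝔖.supp x := by
  ext 𝔠
  rw [Function.mem_support, Set.mem_preimage, mem_supp_iff]

/-- **Dictionary, cardinality of supports.**  For a cuspidal `x` the abstract support has the (possibly infinite)
cardinality of `supp x`.  [cite: MochizukiEtTh2009, Prop 5.3 proof p.326 (PDF p.100)] -/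
theorem encard_support_ord_of_isCuspidalGp {x : Algebra.GrothendieckGroup 𝔉.PhiAcirc} (hx : 𝔖.IsCuspidalGp x) :
    (Function.support fun 𝔠 : {p : Primes 𝔉.PhiAcirc // 𝔓.IsCuspidal p} => 𝔖.ord 𝔠.1 x).encard =
      (𝔖.supp x).encard := by
  rw [support_ord_eq]
  exact Set.encard_preimage_of_injective_subset_range Subtype.val_injective fun 𝔭 h𝔭 => ⟨⟨𝔭, hx 𝔭 h𝔭⟩, rfl⟩

/-! ### The sharp structure theorem -/

/-- **[EtTh] Prop. 5.3 (iv), the situation of p.326 is rigid** (from the intersection theory of the chain).  Let `P`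
be any subgroup of `Φ(A_⊚)^gp` whose elements are exactly those of degree `0` on every irreducible component (the
binder of G-L2d4-2, [EtTh] §1 p.240).  If `a ∈ 𝔞` is primary cuspidal, `n ∈ 𝔫` primary non-cuspidal, `b` cuspidal and
coprime to `a`, and `b − a` is cuspidally minimal (w.r.t. `P`) and linearly equivalent (w.r.t. `P`) to `n`, then for
one integer `m ≥ 1`: `𝔞 ↦ 𝔫` under the surjection of (iv), `n = m·gen 𝔫`, `a = 2m·gen 𝔞`, and
`b = m·gen 𝔠₁ + m·gen 𝔠₂` with `𝔠₁ ↦ 𝔫⁻`, `𝔠₂ ↦ 𝔫⁺` the two neighbours of `𝔫` — "`n₁, n₂` … map … to the two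
non-cuspidal primes that are adjacent … the multiplicities of `n₁, n₂` are equal to each other as well as to half the
multiplicity of `a`" (p.326).  Abstract core: `ChainDivisors.incidence_structure_of_le` (abc-iut-w5-d203).
[cite: MochizukiEtTh2009, Prop 5.3 proof p.326 (PDF p.100); §1 p.240 (PDF p.14)] -/
theorem incidence_structure_of_degree (P : Subgroup (Algebra.GrothendieckGroup 𝔉.PhiAcirc))
    (hI : ∀ x, IsPrincipalOf P x ↔ ∀ 𝔪, 𝔖.degOn 𝔪 x = 0)
    {𝔞 𝔫 : Primes 𝔉.PhiAcirc} (h𝔞 : 𝔓.IsCuspidal 𝔞) (h𝔫 : ¬ 𝔓.IsCuspidal 𝔫) {a b n : 𝔉.PhiAcirc}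
    (ha : a ∈ 𝔞.carrier) (hn : n ∈ 𝔫.carrier)
    (hb : 𝔖.IsCuspidalGp (Algebra.GrothendieckGroup.of b))
    (hcop : CoprimeOf' 𝔖.factor (Algebra.GrothendieckGroup.of a) (Algebra.GrothendieckGroup.of b))
    (hmin : IsCuspidallyMinimalOf' 𝔓 𝔖.factor P
      (Algebra.GrothendieckGroup.of b * (Algebra.GrothendieckGroup.of a)⁻¹))
    (hlin : LinEquivOf P (Algebra.GrothendieckGroup.of b * (Algebra.GrothendieckGroup.of a)⁻¹)
      (Algebra.GrothendieckGroup.of n)) :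
    ∃ (𝔠₁ 𝔠₂ : {p : Primes 𝔉.PhiAcirc // 𝔓.IsCuspidal p}) (m : ℕ), 0 < m ∧
      𝔓.cspToNcsp ⟨𝔞, h𝔞⟩ = ⟨𝔫, h𝔫⟩ ∧
      𝔓.cspToNcsp 𝔠₁ = ncspShift 𝔓 (-1) ⟨𝔫, h𝔫⟩ ∧ 𝔓.cspToNcsp 𝔠₂ = ncspShift 𝔓 1 ⟨𝔫, h𝔫⟩ ∧
      n = 𝔖.gen 𝔫 ^ m ∧ a = 𝔖.gen 𝔞 ^ (2 * m) ∧ b = 𝔖.gen 𝔠₁.1 ^ m * 𝔖.gen 𝔠₂.1 ^ m := by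
  -- the multiplicities of `a` and `n`
  obtain ⟨α, hα, rfl⟩ := (𝔖.mem_carrier_iff 𝔞 a).mp ha
  obtain ⟨k, hk, rfl⟩ := (𝔖.mem_carrier_iff 𝔫 n).mp hn
  set A := Algebra.GrothendieckGroup.of (𝔖.gen 𝔞 ^ α) with hA
  set B := Algebra.GrothendieckGroup.of b with hB
  set N := Algebra.GrothendieckGroup.of (𝔖.gen 𝔫 ^ k) with hN
  set x := B * A⁻¹ with hx
  -- orders of `A` and `N`
  have hordA : 𝔖.ord 𝔞 A = α := by rw [hA, map_pow, ord_pow, ord_gen_self, mul_one]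
  have hordA' : ∀ 𝔮, 𝔮 ≠ 𝔞 → 𝔖.ord 𝔮 A = 0 := fun 𝔮 h => by
    rw [hA, map_pow, ord_pow, 𝔖.ord_gen_of_ne h, mul_zero]
  have hordN : 𝔖.ord 𝔫 N = k := by rw [hN, map_pow, ord_pow, ord_gen_self, mul_one]
  have hordN' : ∀ 𝔮, 𝔮 ≠ 𝔫 → 𝔖.ord 𝔮 N = 0 := fun 𝔮 h => by
    rw [hN, map_pow, ord_pow, 𝔖.ord_gen_of_ne h, mul_zero]
  -- finiteness and cuspidality
  have hfinN : (𝔖.supp N).Finite := 𝔖.supp_finite_of_mem_carrier hn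
  have hfinx : (𝔖.supp x).Finite := hmin.2.1
  have hcuspx : 𝔖.IsCuspidalGp x := hmin.1
  -- orders of `x`: those of `b` away from `𝔞`, `−α` at `𝔞`
  have hordxB : ∀ 𝔮, 𝔮 ≠ 𝔞 → 𝔖.ord 𝔮 x = 𝔖.ord 𝔮 B := fun 𝔮 h => by
    rw [hx, ord_mul, ord_inv, hordA' 𝔮 h, neg_zero, add_zero]
  have h𝔞B : 𝔖.ord 𝔞 B = 0 := by
    apply 𝔖.ord_eq_zero_of_notMem_supp
    intro h
    have h𝔞A : 𝔞 ∈ 𝔖.supp A := by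
      rw [mem_supp_iff, hordA]; exact Nat.cast_ne_zero.mpr hα.ne'
    exact Set.disjoint_left.mp hcop h𝔞A h
  have hordx𝔞 : 𝔖.ord 𝔞 x = -α := by rw [hx, ord_mul, ord_inv, hordA, h𝔞B, zero_add]
  -- `x ∼ N`: all degrees of `x · N⁻¹` vanish, so `degOn 𝔪 x = degOn 𝔪 N`
  have hxN : IsPrincipalOf P (x * N⁻¹) := (isPrincipalOf_iff_mem P _).mpr hlin
  have hdegx : ∀ 𝔪 : {p : Primes 𝔉.PhiAcirc // ¬ 𝔓.IsCuspidal p}, 𝔖.degOn 𝔪 x =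
      k * ((if 𝔪 = ncspShift 𝔓 1 ⟨𝔫, h𝔫⟩ then 1 else 0) - 2 * (if 𝔪 = ⟨𝔫, h𝔫⟩ then 1 else 0) +
        (if 𝔪 = ncspShift 𝔓 (-1) ⟨𝔫, h𝔫⟩ then 1 else 0)) := by
    intro 𝔪
    have h0 := (hI _).mp hxN 𝔪
    rw [𝔖.degOn_mul 𝔪 hfinx (by rwa [supp_inv]), degOn_inv, 𝔖.degOn_ncsp 𝔪 ⟨𝔫, h𝔫⟩ hordN hordN'] at h0
    linarith
  -- (1) the dictionary: hypotheses of the abstract incidence structure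
  have ha₀ : ∀ 𝔠 : {p : Primes 𝔉.PhiAcirc // 𝔓.IsCuspidal p}, 𝔠 ≠ ⟨𝔞, h𝔞⟩ → 0 ≤ 𝔖.ord 𝔠.1 x := by
    intro 𝔠 h𝔠
    have : 𝔠.1 ≠ 𝔞 := fun e => h𝔠 (Subtype.ext e)
    rw [hordxB _ this, hB]; exact 𝔖.ord_of_nonneg _ _
  have ha₀' : 𝔖.ord (⟨𝔞, h𝔞⟩ : {p : Primes 𝔉.PhiAcirc // 𝔓.IsCuspidal p}).1 x < 0 := by
    change 𝔖.ord 𝔞 x < 0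
    rw [hordx𝔞, neg_lt_zero]; exact Nat.cast_pos.mpr hα
  have hc : (0 : ℚ) < k := Nat.cast_pos.mpr hk
  have hdeg : ChainDivisors.HasDegrees
      (fun 𝔠 : {p : Primes 𝔉.PhiAcirc // 𝔓.IsCuspidal p} => 𝔓.ncspEquivZ (𝔓.cspToNcsp 𝔠))
      (fun i => (k : ℚ) * (ChainDivisors.stencil (𝔓.ncspEquivZ ⟨𝔫, h𝔫⟩) i : ℚ))
      (fun 𝔠 => 𝔖.ord 𝔠.1 x) := by
    intro i
    obtain ⟨𝔪, rfl⟩ := 𝔓.ncspEquivZ.surjective i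
    dsimp only
    rw [← 𝔖.degOn_eq_cuspDeg_of_isCuspidalGp hcuspx 𝔪, hdegx 𝔪]
    congr 1
    unfold ChainDivisors.stencil
    simp only [ncsp_eq_iff, ncspEquivZ_ncspShift]
    split_ifs <;> push_cast <;> first | (exfalso; omega) | norm_num
  -- (2) `𝔞` lies over `𝔫` (the abstract criterion of (iv))
  have hπa : 𝔓.ncspEquivZ (𝔓.cspToNcsp ⟨𝔞, h𝔞⟩) = 𝔓.ncspEquivZ ⟨𝔫, h𝔫⟩ :=
    ChainDivisors.cspToNcsp_criterion
      (π := fun 𝔠 : {p : Primes 𝔉.PhiAcirc // 𝔓.IsCuspidal p} => 𝔓.ncspEquivZ (𝔓.cspToNcsp 𝔠))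
      (h := fun 𝔠 => 𝔖.ord 𝔠.1 x) ha₀ hc hdeg
  have h𝔞𝔫 : 𝔓.cspToNcsp ⟨𝔞, h𝔞⟩ = ⟨𝔫, h𝔫⟩ := 𝔓.ncspEquivZ.injective hπa
  -- (3) the three-cusp competitor `k·𝔡₁ + k·𝔡₂ − 2k·𝔞` is linearly equivalent to `x`, so `#supp x ≤ 3`
  obtain ⟨𝔡₁, h𝔡₁⟩ := 𝔓.cspToNcsp_surjective (ncspShift 𝔓 (-1) ⟨𝔫, h𝔫⟩)
  obtain ⟨𝔡₂, h𝔡₂⟩ := 𝔓.cspToNcsp_surjective (ncspShift 𝔓 1 ⟨𝔫, h𝔫⟩)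
  have hle3 : (𝔖.supp x).ncard ≤ 3 := by
    set G₁ := Algebra.GrothendieckGroup.of (𝔖.gen 𝔡₁.1) with hG₁
    set G₂ := Algebra.GrothendieckGroup.of (𝔖.gen 𝔡₂.1) with hG₂
    set G := Algebra.GrothendieckGroup.of (𝔖.gen 𝔞) with hG
    set y := G₁ ^ k * G₂ ^ k * (G ^ (2 * k))⁻¹ with hy
    have hfinG₁ : (𝔖.supp (G₁ ^ k)).Finite := (𝔖.supp_gen_finite _).subset (𝔖.supp_pow_subset _ _)
    have hfinG₂ : (𝔖.supp (G₂ ^ k)).Finite := (𝔖.supp_gen_finite _).subset (𝔖.supp_pow_subset _ _)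
    have hfinG : (𝔖.supp (G ^ (2 * k))).Finite := (𝔖.supp_gen_finite _).subset (𝔖.supp_pow_subset _ _)
    have hfin12 : (𝔖.supp (G₁ ^ k * G₂ ^ k)).Finite := (hfinG₁.union hfinG₂).subset (𝔖.supp_mul_subset _ _)
    have hfiny : (𝔖.supp y).Finite :=
      (hfin12.union (by rwa [supp_inv] : (𝔖.supp (G ^ (2 * k))⁻¹).Finite)).subset (𝔖.supp_mul_subset _ _)
    have hsuby : 𝔖.supp y ⊆ {𝔡₁.1, 𝔡₂.1, 𝔞} := by
      intro 𝔭 h𝔭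
      rcases 𝔖.supp_mul_subset _ _ h𝔭 with h | h
      · rcases 𝔖.supp_mul_subset _ _ h with h | h
        · have := 𝔖.supp_pow_subset _ _ h
          rw [hG₁, supp_gen, Set.mem_singleton_iff] at this
          exact Or.inl this
        · have := 𝔖.supp_pow_subset _ _ h
          rw [hG₂, supp_gen, Set.mem_singleton_iff] at this
          exact Or.inr (Or.inl this)
      · rw [supp_inv] at h
        have := 𝔖.supp_pow_subset _ _ h
        rw [hG, supp_gen, Set.mem_singleton_iff] at this
        exact Or.inr (Or.inr this)
    have hcuspy : 𝔖.IsCuspidalGp y := by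
      intro 𝔭 h𝔭
      rcases hsuby h𝔭 with h | h | h
      · rw [h]; exact 𝔡₁.2
      · rw [h]; exact 𝔡₂.2
      · rw [Set.mem_singleton_iff] at h; rw [h]; exact h𝔞
    have hncardy : (𝔖.supp y).ncard ≤ 3 := by
      refine (Set.ncard_le_ncard hsuby (Set.toFinite _)).trans ?_
      refine (Set.ncard_insert_le _ _).trans ?_
      have := Set.ncard_insert_le 𝔡₂.1 ({𝔞} : Set (Primes 𝔉.PhiAcirc))
      rw [Set.ncard_singleton] at this
      omega
    -- the degrees of `y` are those of `x`
    have hdegy : ∀ 𝔪 : {p : Primes 𝔉.PhiAcirc // ¬ 𝔓.IsCuspidal p}, 𝔖.degOn 𝔪 y = 𝔖.degOn 𝔪 x := by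
      intro 𝔪
      rw [hy, 𝔖.degOn_mul 𝔪 hfin12 (by rwa [supp_inv]), degOn_inv, 𝔖.degOn_mul 𝔪 hfinG₁ hfinG₂,
        𝔖.degOn_pow 𝔪 (𝔖.supp_gen_finite _), 𝔖.degOn_pow 𝔪 (𝔖.supp_gen_finite _),
        𝔖.degOn_pow 𝔪 (𝔖.supp_gen_finite _), 𝔖.degOn_gen_cusp 𝔪 𝔡₁, 𝔖.degOn_gen_cusp 𝔪 𝔡₂,
        𝔖.degOn_gen_cusp 𝔪 ⟨𝔞, h𝔞⟩, h𝔡₁, h𝔡₂, h𝔞𝔫, hdegx 𝔪]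
      push_cast
      ring
    have hyx : LinEquivOf P y x := by
      rw [LinEquivOf, ← isPrincipalOf_iff_mem]
      refine (hI _).mpr fun 𝔪 => ?_
      rw [𝔖.degOn_mul 𝔪 hfiny (by rwa [supp_inv]), degOn_inv, hdegy, add_neg_cancel]
    exact (hmin.2.2 y hcuspy hfiny hyx).trans hncardy
  -- (4) the abstract incidence structure
  have hle : (Function.support fun 𝔠 : {p : Primes 𝔉.PhiAcirc // 𝔓.IsCuspidal p} => 𝔖.ord 𝔠.1 x).encard ≤ 3 := by
    rw [𝔖.encard_support_ord_of_isCuspidalGp hcuspx, ← hfinx.cast_ncard_eq]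
    exact_mod_cast hle3
  obtain ⟨-, hva, 𝔠₁, 𝔠₂, hπ₁, hπ₂, hv₁, hv₂, hsupp⟩ :=
    ChainDivisors.incidence_structure_of_le
      (π := fun 𝔠 : {p : Primes 𝔉.PhiAcirc // 𝔓.IsCuspidal p} => 𝔓.ncspEquivZ (𝔓.cspToNcsp 𝔠))
      (h := fun 𝔠 => 𝔖.ord 𝔠.1 x) ha₀ ha₀' hc hdeg hle
  -- (5) reading off `a` and `b`
  have hva' : 𝔖.ord 𝔞 x = -2 * k := hva
  have hαk : α = 2 * k := by
    rw [hordx𝔞] at hva'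
    have : (α : ℚ) = 2 * k := by linarith
    exact_mod_cast this
  have hπ₁' : 𝔓.ncspEquivZ (𝔓.cspToNcsp 𝔠₁) = 𝔓.ncspEquivZ ⟨𝔫, h𝔫⟩ - 1 := hπ₁
  have hπ₂' : 𝔓.ncspEquivZ (𝔓.cspToNcsp 𝔠₂) = 𝔓.ncspEquivZ ⟨𝔫, h𝔫⟩ + 1 := hπ₂
  have hv₁' : 𝔖.ord 𝔠₁.1 x = k := hv₁
  have hv₂' : 𝔖.ord 𝔠₂.1 x = k := hv₂
  have h𝔠₁𝔞 : 𝔠₁.1 ≠ 𝔞 := by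
    intro e
    have : 𝔠₁ = ⟨𝔞, h𝔞⟩ := Subtype.ext e
    rw [this, hπa] at hπ₁'
    linarith
  have h𝔠₂𝔞 : 𝔠₂.1 ≠ 𝔞 := by
    intro e
    have : 𝔠₂ = ⟨𝔞, h𝔞⟩ := Subtype.ext e
    rw [this, hπa] at hπ₂'
    linarith
  have h𝔠₁𝔠₂ : 𝔠₁.1 ≠ 𝔠₂.1 := by
    intro e
    have : 𝔠₁ = 𝔠₂ := Subtype.ext e
    rw [this, hπ₂'] at hπ₁'
    linarith
  have hordB₁ : 𝔖.ord 𝔠₁.1 B = k := by rw [← hordxB _ h𝔠₁𝔞]; exact hv₁'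
  have hordB₂ : 𝔖.ord 𝔠₂.1 B = k := by rw [← hordxB _ h𝔠₂𝔞]; exact hv₂'
  have hordB₀ : ∀ 𝔭, 𝔭 ≠ 𝔠₁.1 → 𝔭 ≠ 𝔠₂.1 → 𝔖.ord 𝔭 B = 0 := by
    intro 𝔭 h₁ h₂
    by_cases h𝔭 : 𝔓.IsCuspidal 𝔭
    · rcases eq_or_ne 𝔭 𝔞 with e | hne
      · rw [e]; exact h𝔞B
      · rw [← hordxB _ hne]
        have : (⟨𝔭, h𝔭⟩ : {p : Primes 𝔉.PhiAcirc // 𝔓.IsCuspidal p}) ∉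
            Function.support (fun 𝔠 : {p : Primes 𝔉.PhiAcirc // 𝔓.IsCuspidal p} => 𝔖.ord 𝔠.1 x) := by
          rw [hsupp]
          rintro (e | e | e)
          · exact hne (congrArg Subtype.val e)
          · exact h₁ (congrArg Subtype.val e)
          · exact h₂ (congrArg Subtype.val e)
        rwa [Function.notMem_support] at this
    · exact 𝔖.ord_eq_zero_of_isCuspidalGp hb h𝔭
  have hb_eq : b = 𝔖.gen 𝔠₁.1 ^ k * 𝔖.gen 𝔠₂.1 ^ k := by
    apply 𝔖.factor_injective
    funext 𝔭
    apply Multiplicative.toAdd.injective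
    rw [← ord_of, ← ord_of]
    change 𝔖.ord 𝔭 B = 𝔖.ord 𝔭 (Algebra.GrothendieckGroup.of (𝔖.gen 𝔠₁.1 ^ k * 𝔖.gen 𝔠₂.1 ^ k))
    rw [map_mul, map_pow, map_pow, ord_mul, ord_pow, ord_pow, ord_gen, ord_gen]
    rcases eq_or_ne 𝔭 𝔠₁.1 with e₁ | e₁
    · rw [e₁, if_pos rfl, if_neg h𝔠₁𝔠₂, hordB₁]; ring
    · rcases eq_or_ne 𝔭 𝔠₂.1 with e₂ | e₂
      · rw [e₂, if_neg (Ne.symm h𝔠₁𝔠₂), if_pos rfl, hordB₂]; ring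
      · rw [if_neg e₁, if_neg e₂, hordB₀ 𝔭 e₁ e₂]; ring
  refine ⟨𝔠₁, 𝔠₂, k, hk, h𝔞𝔫, ?_, ?_, rfl, by rw [hαk], hb_eq⟩
  · exact (eq_ncspShift_iff _ _ _).mpr (by rw [hπ₁']; ring)
  · exact (eq_ncspShift_iff _ _ _).mpr hπ₂'

/-! ### F3 `incidence`, derived -/

/-- **The F3 sentence of p.326 for any "principal ⇔ degree `0`" subgroup `P`**: "in this situation, `n` is linearly
equivalent to some element ∈ `Φ(A_⊚)^gp` of the form `n₁ + n₂ − a`, where `n₁, n₂ ∈ Φ(A_⊚)^csp` are primary cuspidal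
elements that map, respectively, via the natural surjection of (iv) to the two non-cuspidal primes that are adjacent …
to the non-cuspidal prime determined by `n`. Moreover, … the multiplicities of `n₁, n₂` are equal to each other as
well as to half the multiplicity of `a`."  [cite: MochizukiEtTh2009, Prop 5.3 proof p.326 (PDF p.100); §1 p.240 (PDF p.14)] -/
theorem incidence_of_degree (P : Subgroup (Algebra.GrothendieckGroup 𝔉.PhiAcirc))
    (hI : ∀ x, IsPrincipalOf P x ↔ ∀ 𝔪, 𝔖.degOn 𝔪 x = 0)
    (𝔞 𝔫 : Primes 𝔉.PhiAcirc) (h𝔫 : ¬ 𝔓.IsCuspidal 𝔫) (a b n : 𝔉.PhiAcirc) :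
    𝔓.IsCuspidal 𝔞 → a ∈ 𝔞.carrier → n ∈ 𝔫.carrier →
    IsCuspidalGpOf' 𝔓 𝔖.factor (Algebra.GrothendieckGroup.of b) →
    CoprimeOf' 𝔖.factor (Algebra.GrothendieckGroup.of a) (Algebra.GrothendieckGroup.of b) →
    IsCuspidallyMinimalOf' 𝔓 𝔖.factor P
      (Algebra.GrothendieckGroup.of b * (Algebra.GrothendieckGroup.of a)⁻¹) →
    LinEquivOf P (Algebra.GrothendieckGroup.of b * (Algebra.GrothendieckGroup.of a)⁻¹)
      (Algebra.GrothendieckGroup.of n) →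
    ∃ (𝔠₁ 𝔠₂ : Primes 𝔉.PhiAcirc) (h₁ : 𝔓.IsCuspidal 𝔠₁) (h₂ : 𝔓.IsCuspidal 𝔠₂) (m : ℕ),
      𝔓.ncspEquivZ (𝔓.cspToNcsp ⟨𝔠₁, h₁⟩) = 𝔓.ncspEquivZ ⟨𝔫, h𝔫⟩ - 1 ∧
      𝔓.ncspEquivZ (𝔓.cspToNcsp ⟨𝔠₂, h₂⟩) = 𝔓.ncspEquivZ ⟨𝔫, h𝔫⟩ + 1 ∧
      ordOf' 𝔖.factor 𝔞 a = Multiplicative.ofAdd (2 * (m : ℚ)) ∧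
      LinEquivOf P (Algebra.GrothendieckGroup.of n)
        (Algebra.GrothendieckGroup.of (𝔖.gen 𝔠₁ ^ m * 𝔖.gen 𝔠₂ ^ m) *
          (Algebra.GrothendieckGroup.of a)⁻¹) := by
  intro h𝔞 ha hn hb hcop hmin hlin
  obtain ⟨𝔠₁, 𝔠₂, m, -, -, h₁, h₂, -, rfl, rfl⟩ :=
    𝔖.incidence_structure_of_degree P hI h𝔞 h𝔫 ha hn hb hcop hmin hlin
  refine ⟨𝔠₁.1, 𝔠₂.1, 𝔠₁.2, 𝔠₂.2, m, ?_, ?_, ?_, linEquivOf_symm P hlin⟩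
  · show 𝔓.ncspEquivZ (𝔓.cspToNcsp 𝔠₁) = _
    rw [(eq_ncspShift_iff _ _ _).mp h₁]; ring
  · show 𝔓.ncspEquivZ (𝔓.cspToNcsp 𝔠₂) = _
    exact (eq_ncspShift_iff _ _ _).mp h₂
  · change 𝔖.factor (𝔖.gen 𝔞 ^ (2 * m)) 𝔞 = Multiplicative.ofAdd (2 * (m : ℚ))
    rw [map_pow, Pi.pow_apply, 𝔖.factor_gen_self, ← ofAdd_nsmul, nsmul_eq_mul, mul_one]
    simp only [Nat.cast_mul, Nat.cast_ofNat]

/-- **F3 `DivisorSupportData'.incidence` is REDUNDANT given the binder `hInt`**: under `PrincipalIffDegreeZero` the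
type of the field `incidence` is a theorem of the remaining data (F2 and the p.326 definitions) — proved here without
using the field.  [cite: MochizukiEtTh2009, Prop 5.3 proof p.326 (PDF p.100); §1 p.240 (PDF p.14)] -/
theorem incidence_of_principalIffDegreeZero (hI : 𝔖.PrincipalIffDegreeZero)
    (𝔞 𝔫 : Primes 𝔉.PhiAcirc) (h𝔫 : ¬ 𝔓.IsCuspidal 𝔫) (a b n : 𝔉.PhiAcirc) :
    𝔓.IsCuspidal 𝔞 → a ∈ 𝔞.carrier → n ∈ 𝔫.carrier →
    IsCuspidalGpOf' 𝔓 𝔖.factor (Algebra.GrothendieckGroup.of b) →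
    CoprimeOf' 𝔖.factor (Algebra.GrothendieckGroup.of a) (Algebra.GrothendieckGroup.of b) →
    IsCuspidallyMinimalOf' 𝔓 𝔖.factor 𝔖.principal
      (Algebra.GrothendieckGroup.of b * (Algebra.GrothendieckGroup.of a)⁻¹) →
    LinEquivOf 𝔖.principal (Algebra.GrothendieckGroup.of b * (Algebra.GrothendieckGroup.of a)⁻¹)
      (Algebra.GrothendieckGroup.of n) →
    ∃ (𝔠₁ 𝔠₂ : Primes 𝔉.PhiAcirc) (h₁ : 𝔓.IsCuspidal 𝔠₁) (h₂ : 𝔓.IsCuspidal 𝔠₂) (m : ℕ),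
      𝔓.ncspEquivZ (𝔓.cspToNcsp ⟨𝔠₁, h₁⟩) = 𝔓.ncspEquivZ ⟨𝔫, h𝔫⟩ - 1 ∧
      𝔓.ncspEquivZ (𝔓.cspToNcsp ⟨𝔠₂, h₂⟩) = 𝔓.ncspEquivZ ⟨𝔫, h𝔫⟩ + 1 ∧
      ordOf' 𝔖.factor 𝔞 a = Multiplicative.ofAdd (2 * (m : ℚ)) ∧
      LinEquivOf 𝔖.principal (Algebra.GrothendieckGroup.of n)
        (Algebra.GrothendieckGroup.of (𝔖.gen 𝔠₁ ^ m * 𝔖.gen 𝔠₂ ^ m) *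
          (Algebra.GrothendieckGroup.of a)⁻¹) :=
  𝔖.incidence_of_degree 𝔖.principal hI 𝔞 𝔫 h𝔫 a b n

/-- In the situation of (iv) the surjection sends `𝔞` to `𝔫` — the criterion `CspToNcspCriterion'` for an arbitrary
"principal ⇔ degree `0`" subgroup `P` (the `𝔖.principal` case with only the "⇒" half is
`cspToNcspCriterion'_of_degree`).  [cite: MochizukiEtTh2009, Prop 5.3 proof p.326 (PDF p.100)] -/
theorem cspToNcsp_eq_of_degree (P : Subgroup (Algebra.GrothendieckGroup 𝔉.PhiAcirc))
    (hI : ∀ x, IsPrincipalOf P x ↔ ∀ 𝔪, 𝔖.degOn 𝔪 x = 0)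
    {𝔞 𝔫 : Primes 𝔉.PhiAcirc} (h𝔞 : 𝔓.IsCuspidal 𝔞) (h𝔫 : ¬ 𝔓.IsCuspidal 𝔫) {a b n : 𝔉.PhiAcirc}
    (ha : a ∈ 𝔞.carrier) (hn : n ∈ 𝔫.carrier)
    (hb : 𝔖.IsCuspidalGp (Algebra.GrothendieckGroup.of b))
    (hcop : CoprimeOf' 𝔖.factor (Algebra.GrothendieckGroup.of a) (Algebra.GrothendieckGroup.of b))
    (hmin : IsCuspidallyMinimalOf' 𝔓 𝔖.factor P
      (Algebra.GrothendieckGroup.of b * (Algebra.GrothendieckGroup.of a)⁻¹))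
    (hlin : LinEquivOf P (Algebra.GrothendieckGroup.of b * (Algebra.GrothendieckGroup.of a)⁻¹)
      (Algebra.GrothendieckGroup.of n)) :
    𝔓.cspToNcsp ⟨𝔞, h𝔞⟩ = ⟨𝔫, h𝔫⟩ := by
  obtain ⟨_, _, _, -, h, -⟩ := 𝔖.incidence_structure_of_degree P hI h𝔞 h𝔫 ha hn hb hcop hmin hlin
  exact h

end DivisorSupportData'

end FrobenioidThetaDivisors

end Literature.AnabelianGeometry.EtaleTheta
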